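import Literature.Topology.FourManifolds.PreliminaryRearrangement
import Literature.Topology.FourManifolds.Morse
import HarnessLib

/-!
# Moving the top critical value of a handle attachment to a prescribed height

Topic `Literature/Topology/FourManifolds` (fact seat
`provefact-Literature.Topology.FourManifolds.IsHandlebody.exists_diffeomorph_isBoundaryGluing_sphere`,
step F2b₁ of the Lickorish–Wallace DAG; bookkeeping for the level-preserving handle-extension
step to which L1 `oneHandle_nonempty_diffeomorph` is reduced in
`HandleAttachmentNormalisation.lean`).  Everything here is **proved**; no named facts.

The handle-extension data `Literature.Topology.FourManifolds.HandlePair` (`HandleConjugation.lean`)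
compares two sides whose cut levels differ by exactly the difference of the critical *values*
(`HandlePair.ha : a' = a + (f' p' - f p)`): the two critical points must sit at the same height
above the cut levels.  After the level normalisation the cut levels `b`, `b'` are tied together
(`f' ∘ Ψ₁ = F + (b' - b)`), but the heights `F p - b`, `f' p' - b'` are unrelated.  This file
adjusts one of them: post-composing `F` with a reparametrisation `φ` of the values
(`exists_levelShift`, `PreliminaryRearrangement.lean`: `φ' > 0`, `φ = id` below a level
`a₀ + δ` with `b < a₀` and near `1`, `φ = id + (h - F p)` near `F p`; Milnor, *Lectures on the
h-cobordism theorem* (1965), the function `G(x, 0)` in the proof of Thm. 4.1, PDF p. 22)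
gives a Morse function `φ ∘ F` adapted to the boundary, **equal to `F` on `{F ≤ b + δ'}`**
(so with the same sublevel set `{F ≤ b}`, the same level `b`, and compatible with any
diffeomorphism of `{F ≤ b}`), with the same critical points and indices, and whose unique
critical point above `b` now has the **prescribed value `h ∈ (b, 1)`**
(`IsMorseAdapted.exists_eq_on_sublevel_apply_eq`).

## References

* J. Milnor, *Lectures on the h-cobordism theorem* (1965), proof of Thm. 4.1 (PDF p. 22),
  properties (i)–(iii) of `G`; Thm. 4.1 (b), (c). [MilnorHCobordism1965]
-/

open scoped Manifold ContDiff Topology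
open Set Function Filter

noncomputable section

namespace Literature.Topology.FourManifolds

universe u

variable {n : ℕ} {M : Type u} [TopologicalSpace M] [ChartedSpace (EuclideanHalfSpace (n + 1)) M]

/-- **Prescribing the top critical value.**  Let `F` be a Morse function adapted to `∂M`, `b`
a level through no critical point above which `F` has exactly one critical point, and
`h ∈ (b, 1)`.  Then there is a Morse function `F₂` adapted to `∂M` with: `F₂ = F` on
`{F ≤ b + δ}` for some `δ > 0` (in particular `{F₂ ≤ b} = {F ≤ b}` pointwise and `b` is again a
level through no critical point), the same critical points as `F`, near each of which
`F₂ = F + const` (so the same Morse indices), exactly one critical point above `b`, and **that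
critical point has value `h`**.  (`F₂ = φ ∘ F` for the value reparametrisation `φ` of
`exists_levelShift`.) [cite: MilnorHCobordism1965, proof of Thm. 4.1 (PDF p. 22)] -/
theorem IsMorseAdapted.exists_eq_on_sublevel_apply_eq {F : M → ℝ} (hF : IsMorseAdapted (𝓡∂ (n + 1)) F)
    {b : ℝ} (hcrit : ∀ z, IsMCriticalPt (𝓡∂ (n + 1)) F z → F z ≠ b)
    (hex : ∃! z, IsMCriticalPt (𝓡∂ (n + 1)) F z ∧ b < F z) {h : ℝ} (hbh : b < h) (hh1 : h < 1) :
    ∃ F₂ : M → ℝ, IsMorseAdapted (𝓡∂ (n + 1)) F₂ ∧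
      (∃ δ > 0, ∀ x, F x ≤ b + δ → F₂ x = F x) ∧
      (∀ x, F₂ x ≤ b ↔ F x ≤ b) ∧
      (∀ z, IsMCriticalPt (𝓡∂ (n + 1)) F₂ z ↔ IsMCriticalPt (𝓡∂ (n + 1)) F z) ∧
      (∀ z, IsMCriticalPt (𝓡∂ (n + 1)) F z → ∃ k : ℝ, F₂ =ᶠ[𝓝 z] fun y => F y + k) ∧
      (∀ z, IsMCriticalPt (𝓡∂ (n + 1)) F z → morseIndex (𝓡∂ (n + 1)) F₂ z = morseIndex (𝓡∂ (n + 1)) F z) ∧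
      (∀ z, IsMCriticalPt (𝓡∂ (n + 1)) F₂ z → F₂ z ≠ b) ∧
      (∃! z, IsMCriticalPt (𝓡∂ (n + 1)) F₂ z ∧ b < F₂ z) ∧
      (∀ z, IsMCriticalPt (𝓡∂ (n + 1)) F₂ z → b < F₂ z → F₂ z = h) := by
  obtain ⟨p, ⟨hpc, hpb⟩, huniq⟩ := hex
  -- the top critical point is interior, so its value is `< 1`
  have hp1 : F p < 1 := by
    refine hF.2.2 p (((𝓡∂ (n + 1)).isInteriorPoint_or_isBoundaryPoint p).resolve_right fun hbd => ?_)
    exact (hF.2.1 p hbd).2 hpc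
  set u := F p with hu
  -- the reparametrisation of the values
  set a₀ : ℝ := (b + min u h) / 2 with ha₀
  have ha₀b : b < a₀ := by
    rw [ha₀]; have := lt_min hpb hbh; linarith
  have ha₀u : a₀ < u := by
    rw [ha₀]; have := min_le_left u h; linarith
  have ha₀h : a₀ < h := by
    rw [ha₀]; have := min_le_right u h; linarith
  obtain ⟨φ, hφs, hφd, hφpos, hφmono, δ, hδ, hφlow, hφhigh, hφmid⟩ :=
    exists_levelShift (a₀ := a₀) (a₁ := 1) (u := u) (u' := h) ⟨ha₀u, hp1⟩ ⟨ha₀h, hh1⟩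
  have hφ1 : φ 1 = 1 := hφhigh 1 (by linarith)
  set F₂ : M → ℝ := fun x => φ (F x) with hF₂
  have hF₂s : ContMDiff (𝓡∂ (n + 1)) 𝓘(ℝ, ℝ) ∞ F₂ := hφs.comp_contMDiff hF.isMorse.contMDiff
  -- criticality is unchanged
  have hcritiff : ∀ z, IsMCriticalPt (𝓡∂ (n + 1)) F₂ z ↔ IsMCriticalPt (𝓡∂ (n + 1)) F z := fun z =>
    isMCriticalPt_real_comp_iff (hφd (F z)) (hφpos (F z)).ne'
      ((hF.isMorse.contMDiff z).mdifferentiableAt (by simp))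
  -- `F₂ = F` on `{F ≤ a₀ + δ}`, `F₂ = F + (h - u)` near `p`
  have hlow : ∀ x, F x ≤ a₀ + δ → F₂ x = F x := fun x hx => hφlow (F x) hx
  have hloc : ∀ z, IsMCriticalPt (𝓡∂ (n + 1)) F z → ∃ k : ℝ, F₂ =ᶠ[𝓝 z] fun y => F y + k := by
    intro z hz
    by_cases hzb : b < F z
    · have hzp : z = p := huniq z ⟨hz, hzb⟩
      subst hzp
      refine ⟨h - u, ?_⟩
      have hmem : ∀ᶠ y in 𝓝 z, F y ∈ Ioo (u - δ) (u + δ) :=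
        hF.isMorse.contMDiff.continuous.continuousAt.eventually_mem (Ioo_mem_nhds (by linarith) (by linarith))
      filter_upwards [hmem] with y hy
      exact hφmid (F y) hy
    · refine ⟨0, ?_⟩
      have hlt : F z < a₀ + δ := by
        have := hcrit z hz
        have h1 : F z < b := lt_of_le_of_ne (not_lt.1 hzb) this
        linarith
      have hmem : ∀ᶠ y in 𝓝 z, F y < a₀ + δ :=
        hF.isMorse.contMDiff.continuous.continuousAt.eventually_lt continuousAt_const hlt
      filter_upwards [hmem] with y hy
      rw [add_zero]; exact hlow y hy.le
  -- Morse, adapted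
  have hF₂M : IsMorse (𝓡∂ (n + 1)) F₂ := by
    refine ⟨hF₂s, fun z hz => ?_⟩
    obtain ⟨k, hk⟩ := hloc z ((hcritiff z).1 hz)
    rw [mhessian_congr_of_eventuallyEq_add_const hk]
    exact hF.isMorse.nondegenerate ((hcritiff z).1 hz)
  have hF₂ad : IsMorseAdapted (𝓡∂ (n + 1)) F₂ := by
    refine ⟨hF₂M, fun x hx => ⟨?_, fun hc => (hF.2.1 x hx).2 ((hcritiff x).1 hc)⟩, fun x hx => ?_⟩
    · show φ (F x) = 1
      rw [(hF.2.1 x hx).1, hφ1]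
    · show φ (F x) < 1
      rw [← hφ1]; exact hφmono (hF.2.2 x hx)
  -- values above `a₀ + δ` stay above
  have habove : ∀ x, a₀ + δ < F x → a₀ + δ < F₂ x := by
    intro x hx
    have := hφmono hx
    show a₀ + δ < φ (F x)
    rwa [hφlow (a₀ + δ) le_rfl] at this
  have hsub : ∀ x, F₂ x ≤ b ↔ F x ≤ b := by
    intro x
    by_cases hx : F x ≤ a₀ + δ
    · rw [hlow x hx]
    · have h1 := habove x (not_le.1 hx)
      constructor
      · intro h2; linarith
      · intro h2; linarith [not_le.1 hx]
  refine ⟨F₂, hF₂ad, ⟨a₀ + δ - b, by linarith, fun x hx => hlow x (by linarith)⟩, hsub, hcritiff, hloc,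
    fun z hz => ?_, fun z hz => ?_, ?_, fun z hz hzb => ?_⟩
  · obtain ⟨k, hk⟩ := hloc z hz
    exact morseIndex_congr_of_eventuallyEq_add_const hk
  · intro hzb
    have hzc := (hcritiff z).1 hz
    by_cases hx : F z ≤ a₀ + δ
    · rw [hlow z hx] at hzb; exact hcrit z hzc hzb
    · have := habove z (not_le.1 hx); linarith
  · refine ⟨p, ⟨(hcritiff p).2 hpc, ?_⟩, fun z hz => ?_⟩
    · show b < φ (F p)
      rw [hφmid (F p) ⟨by linarith, by linarith⟩]; linarith
    · have hzc := (hcritiff z).1 hz.1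
      refine huniq z ⟨hzc, ?_⟩
      by_contra hzb
      have hzb' : F z < b := lt_of_le_of_ne (not_lt.1 hzb) (hcrit z hzc)
      have := hlow z (by linarith)
      linarith [hz.2]
  · have hzc := (hcritiff z).1 hz
    have hzb' : b < F z := by
      by_contra h'
      have h'' : F z < b := lt_of_le_of_ne (not_lt.1 h') (hcrit z hzc)
      have := hlow z (by linarith)
      linarith
    have hzp : z = p := huniq z ⟨hzc, hzb'⟩
    subst hzp
    show φ (F z) = h
    rw [hφmid (F z) ⟨by linarith, by linarith⟩]; ring

end Literature.Topology.FourManifolds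

end
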